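import Literature.NumberTheory.ComplexMultiplication.ReflexNormIdeleTorsionCongruence
import Literature.NumberTheory.ComplexMultiplication.ReflexNormDeterminantTransitivity
import Literature.NumberTheory.ComplexMultiplication.HeckeCharactersOfReflexNormSectionLatticeClause
import HarnessLib

/-!
# Main theorem of complex multiplication — the level's Frobenius arithmetic (`β = g(d₀)⁻¹`, `q = N𝔭`, `ν = N((s))`)

[Shimura1998] G. Shimura, *Abelian varieties with complex multiplication and modular functions*, Princeton 1998,
§18.5 (18.5c) p. 124 and §18.6, proof of Thm. 18.6, pp. 127–129 («`𝔮 = g(𝔭)`» p. 127, «`𝔮⁻¹𝔞 = g(c)⁻¹𝔞 = g(d⁻¹)g(s⁻¹)𝔞`» p. 128,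
«`g(d)g(d)^ρ = N(d𝔯) = N(s𝔯)⁻¹N(c𝔯) = N(s𝔯)⁻¹p`» p. 129, «First suppose `ℓ ≠ p`» p. 128).

Topic: the ARITHMETIC HALF of the level-`N` structure (row II-1 S7a of the h21 programme; junction predicate
`IsLevelUniformization`, conjuncts 2–6 «the level's Frobenius arithmetic»): theorems only, no definition, no named
fact.  INPUT = the two last clauses of the tree's TT-idèle theorem
`exists_reflexNorm_torsionCongruence_of_abRestrict_ideleArtinMap_eq_galFrob` for Shimura's prime idèle `c` at a prime
`𝔭 ∤ M` of `K*` and `s` with `c = s·(d₀)·e`: the LATTICE IDENTITY `g(c)_𝐡⁻¹𝔞 = g(d₀)⁻¹ · g(s)_𝐡⁻¹𝔞` and the NORM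
IDENTITY `N((s_𝐡))·N((d₀)) = N𝔭`.  OUTPUT, with `β := g(d₀)⁻¹` (`g = reflexNormFrom`, Shimura's `N₀ = g` on `K*`),
`𝔟 := g(s)_𝐡⁻¹𝔞`, `q := N𝔭`, `ν := N((s_𝐡)) ∈ ℚ ⊂ K` (LEVEL-INDEPENDENT): `β ≠ 0`, `0 < q`, `q·β·β^ρ = ν` ((18.5c)
`g(d)g(d)^ρ = N_{K*/ℚ}(d)` and `N_{K*/ℚ}(d₀) > 0`, the norm identity), `𝔞 ≤ (β)𝔟` (`(β)𝔟 = 𝔮⁻¹𝔞`, `𝔮 = (g(c)_𝐡)`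
integral), and the `t`-clause `∀ k, ∃ t ∈ 𝔬_K, ℓᵏ ∣ t − 1 ∧ (tβ)𝔟 ≤ 𝔞` for every `ℓ ∣ M` (`𝔮` is coprime to `ℓ`:
`c` is `1` at the places over `M`, hence so is `g(c)_𝐡` — the tree's `reflexNormFiniteIdele_mem_trivialAt` — so no prime
over `ℓ` divides `𝔮`, and `t ∈ 𝔮` with `t ≡ 1 (mod ℓᵏ)` exists by `𝔮 + ℓᵏ𝔬 = 𝔬`).

## Main statements
* `ratCast_pos_of_eq_mul_complexConj` — in a CM field `x x^ρ ∈ ℚ` is positive for `x ≠ 0`.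
* `norm_reflexNorm_source_pos` — `N_{K*/ℚ}(d) > 0` for `d ≠ 0` (via (18.5c) in the CM field `K`).
* `exists_mem_and_pow_dvd_sub_one_of_forall_count_eq_zero` — an integral ideal missing every prime over `ℓ` contains
  `t ≡ 1 (mod ℓᵏ)`.
* `count_toFractionalIdeal_eq_zero_of_mem_trivialAt` — an idèle trivial over `(M)` has ideal prime to every `w ∣ M`.
* `levelArithmetic_of_latticeIdentity` — THE FIVE ARITHMETIC CONJUNCTS from the lattice and norm identities.
* `exists_torsionCongruence_and_levelArithmetic` — assembled with the TT-idèle theorem: from «`[s, K*] = Frob_𝔭` on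
  `C_M`» one `d₀` serving both the torsion congruence (clause (2)_N, all lattices) and the five conjuncts.
-/

noncomputable section

open scoped NumberField nonZeroDivisors

namespace Literature.NumberTheory.ComplexMultiplication

open Literature.AlgebraicGeometry.Motives (CMType)
open Literature.NumberTheory.NumberFields
open Literature.NumberTheory.GaloisRepresentations (ideleGroup principalIdeles principalIdele localUnits galFrob)
open Literature.NumberTheory.Automorphic.FiniteAdeleRing (unitOrd unitOrd_eq_zero_iff toFractionalIdeal
  toFractionalIdeal_ne_zero count_toFractionalIdeal)
open NumberField IsDedekindDomain IsDedekindDomain.HeightOneSpectrum WithZero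
open FractionalIdeal (spanSingleton)

/-! ## §1. Positivity: `x x^ρ > 0` in a CM field; `N_{K*/ℚ}(d) > 0` -/

section Positivity

variable {K : Type} [Field K] [NumberField K] [IsCMField K]

/-- **In a CM field a rational number of the form `x·x^ρ`, `x ≠ 0`, is positive**: under any complex embedding `φ`,
`φ(x x^ρ) = φ(x)·conj(φ(x)) = |φ(x)|² > 0` (`φ ∘ ρ = conj ∘ φ` on a CM field). [cite: Shimura1998, §18.5 (18.5c) p. 124; §5.5 Prop. 15 («ξξ^ρ is totally positive»)] -/
theorem ratCast_pos_of_eq_mul_complexConj {x : K} (hx : x ≠ 0) {r : ℚ}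
    (h : algebraMap ℚ K r = x * IsCMField.complexConj K x) : 0 < r := by
  -- adapted from Literature/NumberTheory/ComplexMultiplication/WeilTorusToSerreGroupOfPrime.lean (norm_pos_of_isCMField)
  obtain ⟨φ⟩ : Nonempty (K →+* ℂ) := inferInstance
  have h1 : (φ (algebraMap ℚ K r) : ℂ) = (r : ℂ) := by rw [eq_ratCast, map_ratCast]
  have h2 : φ (x * IsCMField.complexConj K x) = (Complex.normSq (φ x) : ℂ) := by
    rw [map_mul, IsCMField.complexEmbedding_complexConj (φ := φ) (x := x), Complex.mul_conj]
  have h3 : ((r : ℝ) : ℂ) = ((Complex.normSq (φ x) : ℝ) : ℂ) := by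
    rw [← Complex.ofReal_ratCast] at h1
    rw [← h1, h, h2]
  have h4 : (r : ℝ) = Complex.normSq (φ x) := Complex.ofReal_injective h3
  have h5 : 0 < Complex.normSq (φ x) := Complex.normSq_pos.mpr ((map_ne_zero φ).mpr hx)
  exact_mod_cast h4 ▸ h5

variable (K) (Φ : CMType K) (k : IntermediateField ℚ ℂ) [NumberField k]

/-- **`N_{K*/ℚ}(d) > 0` for `d ≠ 0` in a field `k ⊇ K*`** — from (18.5c) `g(d)·g(d)^ρ = N_{k/ℚ}(d)` in the CM field
`K` (`reflexNormFrom_mul_complexConj_reflexNormFrom`) and `ratCast_pos_of_eq_mul_complexConj`.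
[cite: Shimura1998, §18.5 (18.5c) p. 124] -/
theorem norm_reflexNorm_source_pos (hk : traceField Φ ≤ k) {d : k} (hd : d ≠ 0) : 0 < Algebra.norm ℚ d :=
  ratCast_pos_of_eq_mul_complexConj (reflexNormFrom_ne_zero K Φ k hd)
    (reflexNormFrom_mul_complexConj_reflexNormFrom K Φ k hk d).symm

end Positivity

/-! ## §2. Ideals prime to `ℓ` contain `t ≡ 1 (mod ℓᵏ)`; idèles trivial over `(M)` have ideals prime to `M` -/

section Coprime

variable {K : Type} [Field K] [NumberField K]

/-- **An integral ideal `𝔮` with no prime factor over `ℓ` contains, for every `k`, some `t ≡ 1 (mod ℓᵏ)`**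
(`𝔮 + ℓᵏ𝔬 = 𝔬`: a maximal ideal containing both would contain `ℓ`, hence lie over `ℓ`, and divide `𝔮`).
Hypothesis: `count_w 𝔮 = 0` for every finite prime `w ∋ ℓ`. [cite: Shimura1998, §18.6 proof of Thm. 18.6, p. 128 («First suppose ℓ ≠ p»)] -/
theorem exists_mem_and_pow_dvd_sub_one_of_forall_count_eq_zero {𝔮 : Ideal (𝓞 K)} (h𝔮 : 𝔮 ≠ ⊥) {ℓ : ℕ}
    (hℓ : ∀ w : HeightOneSpectrum (𝓞 K), (ℓ : 𝓞 K) ∈ w.asIdeal →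
      FractionalIdeal.count K w (𝔮 : FractionalIdeal (𝓞 K)⁰ K) = 0)
    (n : ℕ) : ∃ t : 𝓞 K, t ∈ 𝔮 ∧ ((ℓ ^ n : ℕ) : 𝓞 K) ∣ t - 1 := by
  classical
  have hsup : 𝔮 ⊔ Ideal.span {((ℓ ^ n : ℕ) : 𝓞 K)} = ⊤ := by
    by_contra hne
    obtain ⟨w, hwmax, hle⟩ := Ideal.exists_le_maximal _ hne
    have hℓn : ((ℓ ^ n : ℕ) : 𝓞 K) ∈ w :=
      hle (Ideal.mem_sup_right (Ideal.mem_span_singleton_self _))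
    have hℓw : (ℓ : 𝓞 K) ∈ w := by
      rw [Nat.cast_pow] at hℓn
      exact hwmax.isPrime.mem_of_pow_mem n hℓn
    have hw0 : w ≠ ⊥ := by
      intro hw
      rw [hw] at hle
      exact h𝔮 (le_bot_iff.mp (le_sup_left.trans hle))
    let W : HeightOneSpectrum (𝓞 K) := ⟨w, hwmax.isPrime, hw0⟩
    have hcount := hℓ W hℓw
    have h𝔮W : (𝔮 : FractionalIdeal (𝓞 K)⁰ K) ≤ (W.asIdeal : FractionalIdeal (𝓞 K)⁰ K) :=
      FractionalIdeal.coeIdeal_le_coeIdeal K |>.mpr (le_sup_left.trans hle)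
    have hmono := FractionalIdeal.count_mono K W (FractionalIdeal.coeIdeal_ne_zero.mpr h𝔮) h𝔮W
    rw [FractionalIdeal.count_self, hcount] at hmono
    exact absurd hmono (by norm_num)
  have h1 : (1 : 𝓞 K) ∈ 𝔮 ⊔ Ideal.span {((ℓ ^ n : ℕ) : 𝓞 K)} := hsup ▸ Submodule.mem_top
  obtain ⟨a, ha, b, hb, hab⟩ := Submodule.mem_sup.mp h1
  refine ⟨a, ha, ?_⟩
  have hab' : a - 1 = -b := by rw [← hab]; ring
  rw [hab', dvd_neg]
  exact Ideal.mem_span_singleton.mp hb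

/-- **An idèle trivial at the places over `(M)` has its ideal prime to them**: if `x ∈ trivialAt (M)` (`x_w = 1` for every
`w ∋ M`) then `count_w (il x) = ord_w x_w = 0` for every such `w`. [cite: Shimura1998, §18.6 proof of Thm. 18.6, p. 128 («all other components are 1»)] -/
theorem count_toFractionalIdeal_eq_zero_of_mem_trivialAt {M : ℕ} {x : (FiniteAdeleRing (𝓞 K) K)ˣ}
    (hx : x ∈ IdeleAction.trivialAt (K := K) (Ideal.span {(M : 𝓞 K)})) (w : HeightOneSpectrum (𝓞 K))
    (hw : (M : 𝓞 K) ∈ w.asIdeal) :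
    FractionalIdeal.count K w (toFractionalIdeal (𝓞 K) K x) = 0 := by
  rw [count_toFractionalIdeal, unitOrd_eq_zero_iff]
  have h1 : (x : FiniteAdeleRing (𝓞 K) K) w = 1 := hx w ((Ideal.span_singleton_le_iff_mem _).mpr hw)
  rw [h1, map_one]

end Coprime

/-! ## §3. The five arithmetic conjuncts of the level from the lattice identity and the norm identity -/

section Level

variable (K : Type) [Field K] [NumberField K] [IsCMField K] (Φ : CMType K) (k : IntermediateField ℚ ℂ)
  [NumberField k]

/-- **The level's Frobenius arithmetic** ([Shimura1998] proof of Thm. 18.6, the bookkeeping around (∗∗)/(∗∗∗)): let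
`𝔭 ∤ M` be a finite prime of `k ⊇ K*`, `ϖ` a prime element at `𝔭`, `c = localUnits 𝔭 ϖ` Shimura's prime idèle, `s` an
idèle and `d₀ ∈ k^×` with the LATTICE IDENTITY `g(c)_𝐡⁻¹𝔞 = g(d₀)⁻¹·g(s)_𝐡⁻¹𝔞` and the NORM IDENTITY
`N((s_𝐡))·N((d₀)) = N𝔭` (clauses 3–4 of `exists_reflexNorm_torsionCongruence_of_abRestrict_ideleArtinMap_eq_galFrob`),
and `ℓ ∣ M`, `M ≠ 0`.  Put `β := g(d₀)⁻¹`, `𝔟 := g(s)_𝐡⁻¹𝔞`, `q := N𝔭`, `ν := N((s_𝐡))`.  Then: `β ≠ 0`; `0 < q`;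
`q·β·β^ρ = ν`; `𝔞 ≤ (β)𝔟`; and for every `n` there is `t ∈ 𝔬_K` with `ℓⁿ ∣ t − 1` and `(tβ)𝔟 ≤ 𝔞`.
[cite: Shimura1998, §18.5 (18.5c) p. 124; §18.6 proof of Thm. 18.6, pp. 128–129] -/
theorem levelArithmetic_of_latticeIdentity (hk : traceField Φ ≤ k) {M ℓ : ℕ} (hM : M ≠ 0) (hℓM : ℓ ∣ M)
    {𝔭 : HeightOneSpectrum (𝓞 k)} (h𝔭 : ¬ Ideal.span {(M : 𝓞 k)} ≤ 𝔭.asIdeal) {ϖ : (𝔭.adicCompletion k)ˣ}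
    (hϖ : Valued.v (ϖ : 𝔭.adicCompletion k) = WithZero.exp (-1 : ℤ)) {s : ideleGroup k} {d₀ : kˣ}
    {𝔞 : FractionalIdeal (𝓞 K)⁰ K}
    (h3 : IdeleAction.ideleMulIdeal
        (reflexNormFiniteIdele K Φ k (IdeleAction.finitePart k (localUnits 𝔭 ϖ)))⁻¹ 𝔞 =
      spanSingleton (𝓞 K)⁰ (reflexNormFrom K Φ k d₀)⁻¹ *
        IdeleAction.ideleMulIdeal (reflexNormFiniteIdele K Φ k (IdeleAction.finitePart k s))⁻¹ 𝔞)
    (h4 : FractionalIdeal.absNorm (toFractionalIdeal (𝓞 k) k (IdeleAction.finitePart k s)) *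
        FractionalIdeal.absNorm (spanSingleton (𝓞 k)⁰ (d₀ : k)) = Ideal.absNorm 𝔭.asIdeal) :
    (reflexNormFrom K Φ k d₀)⁻¹ ≠ 0 ∧ 0 < Ideal.absNorm 𝔭.asIdeal ∧
      ((Ideal.absNorm 𝔭.asIdeal : ℕ) : K) * (reflexNormFrom K Φ k d₀)⁻¹ *
          IsCMField.complexConj K (reflexNormFrom K Φ k d₀)⁻¹ =
        ((FractionalIdeal.absNorm (toFractionalIdeal (𝓞 k) k (IdeleAction.finitePart k s)) : ℚ) : K) ∧
      𝔞 ≤ spanSingleton (𝓞 K)⁰ (reflexNormFrom K Φ k d₀)⁻¹ *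
        IdeleAction.ideleMulIdeal (reflexNormFiniteIdele K Φ k (IdeleAction.finitePart k s))⁻¹ 𝔞 ∧
      ∀ n : ℕ, ∃ t : 𝓞 K, ((ℓ ^ n : ℕ) : 𝓞 K) ∣ t - 1 ∧
        spanSingleton (𝓞 K)⁰ ((t : K) * (reflexNormFrom K Φ k d₀)⁻¹) *
          IdeleAction.ideleMulIdeal (reflexNormFiniteIdele K Φ k (IdeleAction.finitePart k s))⁻¹ 𝔞 ≤ 𝔞 := by
  classical
  -- notation
  set g : K := reflexNormFrom K Φ k d₀ with hg_def
  set x : (FiniteAdeleRing (𝓞 K) K)ˣ :=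
    reflexNormFiniteIdele K Φ k (IdeleAction.finitePart k (localUnits 𝔭 ϖ)) with hx_def
  set 𝔮 : FractionalIdeal (𝓞 K)⁰ K := toFractionalIdeal (𝓞 K) K x with h𝔮_def
  have hd₀ : (d₀ : k) ≠ 0 := d₀.ne_zero
  have hg0 : g ≠ 0 := reflexNormFrom_ne_zero K Φ k hd₀
  have hβ0 : g⁻¹ ≠ 0 := inv_ne_zero hg0
  have hq0 : Ideal.absNorm 𝔭.asIdeal ≠ 0 := by
    rw [Ne, Ideal.absNorm_eq_zero_iff]
    exact 𝔭.ne_bot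
  -- `(β)𝔟 = 𝔮⁻¹𝔞`
  have h𝔮0 : 𝔮 ≠ 0 := toFractionalIdeal_ne_zero x
  have hβ𝔟 : spanSingleton (𝓞 K)⁰ g⁻¹ *
      IdeleAction.ideleMulIdeal (reflexNormFiniteIdele K Φ k (IdeleAction.finitePart k s))⁻¹ 𝔞 = 𝔮⁻¹ * 𝔞 := by
    rw [← h3, IdeleAction.ideleMulIdeal_def, toFractionalIdeal_inv]
  -- `𝔮` is integral
  have hϖ1 : Valued.v (ϖ : 𝔭.adicCompletion k) ≤ 1 := by
    rw [hϖ, ← WithZero.exp_zero, WithZero.exp_le_exp]; norm_num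
  have h𝔮1 : 𝔮 ≤ 1 := by
    have h := reflexNorm_ideleMulIdeal_one_le_one K Φ k (𝔭 := 𝔭) hϖ1
    rwa [IdeleAction.ideleMulIdeal_def, mul_one] at h
  obtain ⟨𝔮₀, h𝔮₀⟩ := FractionalIdeal.le_one_iff_exists_coeIdeal.mp h𝔮1
  have h𝔮₀0 : 𝔮₀ ≠ ⊥ := by
    rintro rfl
    exact h𝔮0 (by rw [← h𝔮₀, FractionalIdeal.coeIdeal_bot])
  -- `𝔮` is prime to `ℓ`
  have hxtriv : x ∈ IdeleAction.trivialAt (K := K) (Ideal.span {(M : 𝓞 K)}) :=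
    reflexNormFiniteIdele_mem_trivialAt K Φ k M (finitePart_localUnits_mem_trivialAt h𝔭 ϖ)
  have hcount : ∀ w : HeightOneSpectrum (𝓞 K), (ℓ : 𝓞 K) ∈ w.asIdeal →
      FractionalIdeal.count K w (𝔮₀ : FractionalIdeal (𝓞 K)⁰ K) = 0 := by
    intro w hw
    rw [h𝔮₀]
    refine count_toFractionalIdeal_eq_zero_of_mem_trivialAt hxtriv w ?_
    obtain ⟨m, rfl⟩ := hℓM
    rw [Nat.cast_mul]
    exact w.asIdeal.mul_mem_right _ hw
  refine ⟨hβ0, Nat.pos_of_ne_zero hq0, ?_, ?_, fun n => ?_⟩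
  · -- `q β β^ρ = ν`
    have h185 : g * IsCMField.complexConj K g = algebraMap ℚ K (Algebra.norm ℚ (d₀ : k)) :=
      reflexNormFrom_mul_complexConj_reflexNormFrom K Φ k hk (d₀ : k)
    have hpos : 0 < Algebra.norm ℚ (d₀ : k) := norm_reflexNorm_source_pos K Φ k hk hd₀
    have hN : FractionalIdeal.absNorm (spanSingleton (𝓞 k)⁰ (d₀ : k)) = Algebra.norm ℚ (d₀ : k) := by
      rw [FractionalIdeal.absNorm_span_singleton, abs_of_pos hpos]
    rw [hN] at h4
    have hN0 : (algebraMap ℚ K (Algebra.norm ℚ (d₀ : k))) ≠ 0 :=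
      (map_ne_zero _).mpr hpos.ne'
    have hν : (FractionalIdeal.absNorm (toFractionalIdeal (𝓞 k) k (IdeleAction.finitePart k s)) : ℚ) =
        (Ideal.absNorm 𝔭.asIdeal : ℚ) / Algebra.norm ℚ (d₀ : k) := by
      rw [eq_div_iff hpos.ne', h4]
    rw [map_inv₀, mul_assoc, ← mul_inv, h185, hν, Rat.cast_div, Rat.cast_natCast, div_eq_mul_inv,
      eq_ratCast]
  · -- `𝔞 ≤ (β)𝔟 = 𝔮⁻¹𝔞`
    rw [hβ𝔟]
    have h1 : (1 : FractionalIdeal (𝓞 K)⁰ K) ≤ 𝔮⁻¹ := by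
      rw [← one_div, FractionalIdeal.le_div_iff_mul_le h𝔮0, one_mul]
      exact h𝔮1
    simpa only [one_mul] using mul_le_mul_left h1 𝔞
  · -- the `t`-clause
    obtain ⟨t, ht𝔮, htn⟩ := exists_mem_and_pow_dvd_sub_one_of_forall_count_eq_zero h𝔮₀0 hcount n
    refine ⟨t, htn, ?_⟩
    have hsplit : spanSingleton (𝓞 K)⁰ ((t : K) * g⁻¹) = spanSingleton (𝓞 K)⁰ (t : K) * spanSingleton (𝓞 K)⁰ g⁻¹ :=
      (FractionalIdeal.spanSingleton_mul_spanSingleton _ _).symm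
    rw [hsplit, mul_assoc, hβ𝔟, ← mul_assoc]
    have ht : spanSingleton (𝓞 K)⁰ (t : K) ≤ 𝔮 := by
      rw [FractionalIdeal.spanSingleton_le_iff_mem, ← h𝔮₀]
      exact FractionalIdeal.mem_coeIdeal_of_mem (S := (𝓞 K)⁰) ht𝔮
    calc spanSingleton (𝓞 K)⁰ (t : K) * 𝔮⁻¹ * 𝔞 ≤ 𝔮 * 𝔮⁻¹ * 𝔞 :=
          mul_le_mul_left (mul_le_mul_left ht 𝔮⁻¹) 𝔞
      _ = 𝔞 := by rw [mul_inv_cancel₀ h𝔮0, one_mul]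

/-- **Assembled with the TT-idèle theorem**: from «`[s, K*]|_{C_M} = Frob_𝔭`» on the ray class field modulo `(M)`
(`𝔭 ∤ M`, `ϖ` a prime element at `𝔭`, `ℓ ∣ M`) ONE `d₀ ∈ K*^×` serves both halves of the level-`M` structure: the
TORSION CONGRUENCE «`g(s)_𝐡⁻¹·(u mod 𝔞) = (g(d₀)u mod g(s)_𝐡⁻¹𝔞)` for `u ∈ M⁻¹𝔞`» (every lattice `𝔞`; input of
`CMTypeUniformization.exists_reindex_forall_conj_eq_of_torsionCongruence`) and, for every lattice `𝔞`, the five arithmetic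
conjuncts of `levelArithmetic_of_latticeIdentity`. [cite: Shimura1998, §18.6 proof of Thm. 18.6, pp. 128–129 ((∗∗) p. 128, (∗∗∗) p. 129)] -/
theorem exists_torsionCongruence_and_levelArithmetic (hk : traceField Φ ≤ k) {M ℓ : ℕ} (hM : M ≠ 0) (hℓM : ℓ ∣ M)
    {𝔭 : HeightOneSpectrum (𝓞 k)} (h𝔭 : ¬ Ideal.span {(M : 𝓞 k)} ≤ 𝔭.asIdeal) {ϖ : (𝔭.adicCompletion k)ˣ}
    (hϖ : Valued.v (ϖ : 𝔭.adicCompletion k) = WithZero.exp (-1 : ℤ)) {s : ideleGroup k}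
    (hs : abRestrict (rayClassField k (Ideal.span {(M : 𝓞 k)})) (ideleArtinMap k s) =
      galFrob k (rayClassField k (Ideal.span {(M : 𝓞 k)})) 𝔭) :
    ∃ d₀ : kˣ,
      (∀ (𝔞 : FractionalIdeal (𝓞 K)⁰ K) (h𝔞 : 𝔞 ≠ 0) (u : K), (M : K) * u ∈ 𝔞 →
        IdeleAction.ideleMulEquiv (reflexNormFiniteIdele K Φ k (IdeleAction.finitePart k s))⁻¹ 𝔞 h𝔞
            (Submodule.Quotient.mk u) = Submodule.Quotient.mk (reflexNormFrom K Φ k d₀ * u)) ∧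
      ∀ 𝔞 : FractionalIdeal (𝓞 K)⁰ K,
        (reflexNormFrom K Φ k d₀)⁻¹ ≠ 0 ∧ 0 < Ideal.absNorm 𝔭.asIdeal ∧
        ((Ideal.absNorm 𝔭.asIdeal : ℕ) : K) * (reflexNormFrom K Φ k d₀)⁻¹ *
            IsCMField.complexConj K (reflexNormFrom K Φ k d₀)⁻¹ =
          ((FractionalIdeal.absNorm (toFractionalIdeal (𝓞 k) k (IdeleAction.finitePart k s)) : ℚ) : K) ∧
        𝔞 ≤ spanSingleton (𝓞 K)⁰ (reflexNormFrom K Φ k d₀)⁻¹ *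
          IdeleAction.ideleMulIdeal (reflexNormFiniteIdele K Φ k (IdeleAction.finitePart k s))⁻¹ 𝔞 ∧
        ∀ n : ℕ, ∃ t : 𝓞 K, ((ℓ ^ n : ℕ) : 𝓞 K) ∣ t - 1 ∧
          spanSingleton (𝓞 K)⁰ ((t : K) * (reflexNormFrom K Φ k d₀)⁻¹) *
            IdeleAction.ideleMulIdeal (reflexNormFiniteIdele K Φ k (IdeleAction.finitePart k s))⁻¹ 𝔞 ≤ 𝔞 := by
  obtain ⟨d₀, -, h2, h3, h4⟩ :=
    exists_reflexNorm_torsionCongruence_of_abRestrict_ideleArtinMap_eq_galFrob K Φ k hM h𝔭 hϖ hs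
  exact ⟨d₀, h2, fun 𝔞 => levelArithmetic_of_latticeIdentity K Φ k hk hM hℓM h𝔭 hϖ (h3 𝔞) h4⟩

end Level

end Literature.NumberTheory.ComplexMultiplication

end
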